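import Mathlib
import Literature.Analysis.ValidatedNumerics.MirandaTheorem

/-!
# Route `FilamentSkeletonRss` · ∀-crux `TransverseReduction1AR` (stmt-NavierStokesRegularity-23611) · line `defect_column_gate_1AR` →
# «A1R-acc» (reduction MODULO ACCRETION MODES, director-ns dss_120/122 KEEP-R4 branch): the SELECTION STEP on the (N+1)-box

Helper file (theorems only), `--supports stmt-NavierStokesRegularity-23611 --as helper`; LEAD of 23611, lane ns-filament-21221-p1 g13.

The A1R-acc design (LEAD memo `Cruxes/TransverseReductionRJ/Lines/defect_column_gate_1AL_accretion.md` §8–§9; tenure g26 kit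
`DESIGN-A1Racc-exists-side-g26.md` §3; critic idea-crit-7 K2) closes the route by a Poincaré–Miranda selection over the CORE-AREA BOX
`p ∈ [0,1]^N` times the RATE WINDOW `β ∈ [a, b]`, in the coordinates `(B₁, …, B_N, g)` = (accretion multipliers, rate defect), which the
∀-side delivers JOINTLY CONTINUOUS as `ContinuousOn (fun q : (Fin N → ℝ) × ℝ => (g q.1 q.2, B q.1 q.2)) (cube ×ˢ Icc a b)`, with
faces: `B_j > 0` on `p_j = 0`, `B_j < 0` on `p_j = 1` (from the EXPORTED affine area law `Γ·|B − k·F⁰| ≤ Ce`, `k ≥ k₀ > 0`, and the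
∃-side's face margins `F⁰ ≥ κ` / `F⁰ ≤ −κ`), and `g < 0` at `β = a`, `g > 0` at `β = b`.  This file proves exactly that step, ITEM-TEXT-FREE:

* `exists_zero_of_miranda_mixed` — Miranda's theorem on a box `Icc l u ⊆ ι → ℝ` with a PER-COORDINATE choice of face orientation
  (reduction to the tree's `Literature.Analysis.ValidatedNumerics.Miranda.exists_zero_of_miranda` by flipping the signs of the
  wrongly-oriented components);
* `poincareMiranda_cube_prod` — the PRODUCT-COORDINATE form on `[0,1]^N × [a,b]` for a pair `(B, g)` typed as the glue types it
  (transport along `(Option (Fin N) → ℝ) → (Fin N → ℝ) × ℝ`);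
* `accretionBox_selection` — the face ARITHMETIC of the export law: for `Γ > 0` with `Ce < k₀·κ·Γ` the exported law and the κ-margins put
  `B_j` strictly positive / negative on the two `p_j`-faces, so `(B, g)` has a common zero `(p⋆, β⋆)` in the box.

With these, the future support item `Selection1ARacc : SkeletonBoxR → TransverseReduction1ARacc → RssProfileExists` is: instantiate the box
at `Γ = max (Γ₁, Γ₂, Ce/(k₀κ) + 1)`, read `(g, B, k)` from the ∀-side, apply `accretionBox_selection` with `F⁰_pj = (3/2 − w′_pj(c_pj))·Aa_pj(c_pj) + 4`,
and package the exact profile at `(p⋆, β⋆)` by `Theorems.stub_rssProfileExists_of_profile` (pattern of `boxSelectionRJ_proof`, p555397).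
HONEST FRAMING: finite-dimensional topology/arithmetic for the bookkeeping of a HYPOTHETICAL filament-type rotating-self-similar blow-up route
(MODEL rung, negative side).  Nothing here bears on Navier–Stokes regularity; `TransverseReduction1AR` is neither proved nor refuted; the
A1R-acc items are not yet filed (dss_122: design first).
-/

set_option linter.dupNamespace false

noncomputable section

namespace Summit.NavierStokesRegularity.NavierStokesRegularity.Theorems.DefectColumnGate

open Set Function

/-! ## Miranda with mixed face orientation -/

/-- **Miranda's theorem with a per-coordinate orientation.**  `F` continuous on the box `Icc l u` (`l ≤ u`, finite index type); for the
coordinates in `σ` the book's orientation (`F_i ≤ 0` on the lower face `x_i = l_i`, `F_i ≥ 0` on the upper face `x_i = u_i`), for the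
others the mirror orientation (`F_i ≥ 0` below, `F_i ≤ 0` above).  Then `F` has a zero in the box.  (Apply Miranda to the field whose
`i`-th component is `F_i` or `−F_i` according to `σ`.) -/
theorem exists_zero_of_miranda_mixed {ι : Type*} [Fintype ι] {l u : ι → ℝ} {F : (ι → ℝ) → ι → ℝ} (σ : Set ι)
    (hlu : l ≤ u) (hF : ContinuousOn F (Icc l u))
    (hlo : ∀ x ∈ Icc l u, ∀ i, x i = l i → (i ∈ σ → F x i ≤ 0) ∧ (i ∉ σ → 0 ≤ F x i))
    (hup : ∀ x ∈ Icc l u, ∀ i, x i = u i → (i ∈ σ → 0 ≤ F x i) ∧ (i ∉ σ → F x i ≤ 0)) :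
    ∃ x ∈ Icc l u, F x = 0 := by
  classical
  obtain ⟨x, hx, h0⟩ := Literature.Analysis.ValidatedNumerics.Miranda.exists_zero_of_miranda
    (F := fun x i => if i ∈ σ then F x i else -F x i) hlu
    (by
      refine continuousOn_pi.2 fun i => ?_
      have hFi : ContinuousOn (fun x => F x i) (Icc l u) := (continuous_apply i).comp_continuousOn hF
      by_cases hi : i ∈ σ
      · simp only [hi, ↓reduceIte]; exact hFi
      · simp only [hi, ↓reduceIte]; exact hFi.neg)
    (fun x hx i hi => by
      by_cases hs : i ∈ σ
      · simp only [hs, ↓reduceIte]; exact (hlo x hx i hi).1 hs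
      · simp only [hs, ↓reduceIte, neg_nonpos]; exact (hlo x hx i hi).2 hs)
    (fun x hx i hi => by
      by_cases hs : i ∈ σ
      · simp only [hs, ↓reduceIte]; exact (hup x hx i hi).1 hs
      · simp only [hs, ↓reduceIte, neg_nonneg]; exact (hup x hx i hi).2 hs)
  refine ⟨x, hx, funext fun i => ?_⟩
  have hi := congrFun h0 i
  by_cases hs : i ∈ σ
  · simpa [hs] using hi
  · simpa [hs] using hi

/-! ## The product-coordinate form on `[0,1]^N × [a,b]` -/

/-- **Poincaré–Miranda on the (N+1)-box in product coordinates.**  `B : cube × window → ℝ^N` and `g : cube × window → ℝ`, jointly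
continuous on `[0,1]^N × [a,b]` (stated exactly as the A1R-acc ∀-side states it), with `B_j ≥ 0` on the face `p_j = 0`, `B_j ≤ 0` on
`p_j = 1`, `g ≤ 0` at `β = a`, `g ≥ 0` at `β = b`: then some `(p⋆, β⋆)` in the box has `B(p⋆, β⋆) = 0` and `g(p⋆, β⋆) = 0`. -/
theorem poincareMiranda_cube_prod (N : ℕ) {a b : ℝ} (hab : a ≤ b)
    (B : (Fin N → ℝ) → ℝ → Fin N → ℝ) (g : (Fin N → ℝ) → ℝ → ℝ)
    (hcont : ContinuousOn (fun q : (Fin N → ℝ) × ℝ => (g q.1 q.2, B q.1 q.2))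
      ({p : Fin N → ℝ | ∀ i, p i ∈ Icc (0:ℝ) 1} ×ˢ Icc a b))
    (hB0 : ∀ p : Fin N → ℝ, (∀ i, p i ∈ Icc (0:ℝ) 1) → ∀ β ∈ Icc a b, ∀ j, p j = 0 → 0 ≤ B p β j)
    (hB1 : ∀ p : Fin N → ℝ, (∀ i, p i ∈ Icc (0:ℝ) 1) → ∀ β ∈ Icc a b, ∀ j, p j = 1 → B p β j ≤ 0)
    (hga : ∀ p : Fin N → ℝ, (∀ i, p i ∈ Icc (0:ℝ) 1) → g p a ≤ 0)
    (hgb : ∀ p : Fin N → ℝ, (∀ i, p i ∈ Icc (0:ℝ) 1) → 0 ≤ g p b) :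
    ∃ (p : Fin N → ℝ) (β : ℝ), (∀ i, p i ∈ Icc (0:ℝ) 1) ∧ β ∈ Icc a b ∧ (∀ j, B p β j = 0) ∧ g p β = 0 := by
  classical
  -- coordinates on `Option (Fin N) → ℝ`: `none` = the rate coordinate, `some j` = the `j`-th core-area coordinate
  let l : Option (Fin N) → ℝ := fun o => o.elim a (fun _ => 0)
  let u : Option (Fin N) → ℝ := fun o => o.elim b (fun _ => 1)
  let π₁ : (Option (Fin N) → ℝ) → (Fin N → ℝ) := fun x i => x (some i)
  let F : (Option (Fin N) → ℝ) → Option (Fin N) → ℝ :=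
    fun x o => o.elim (g (π₁ x) (x none)) (fun j => - B (π₁ x) (x none) j)
  have hlu : l ≤ u := fun o => by
    cases o with
    | none => exact hab
    | some _ => exact zero_le_one
  have hmem : ∀ x ∈ Icc l u, (∀ i, π₁ x i ∈ Icc (0:ℝ) 1) ∧ x none ∈ Icc a b := by
    intro x hx
    rw [mem_Icc, Pi.le_def, Pi.le_def] at hx
    exact ⟨fun i => ⟨hx.1 (some i), hx.2 (some i)⟩, ⟨hx.1 none, hx.2 none⟩⟩
  have hπc : Continuous fun x : Option (Fin N) → ℝ => ((π₁ x, x none) : (Fin N → ℝ) × ℝ) :=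
    (continuous_pi fun i => continuous_apply (some i)).prodMk (continuous_apply none)
  have hmaps : MapsTo (fun x : Option (Fin N) → ℝ => ((π₁ x, x none) : (Fin N → ℝ) × ℝ)) (Icc l u)
      ({p : Fin N → ℝ | ∀ i, p i ∈ Icc (0:ℝ) 1} ×ˢ Icc a b) :=
    fun x hx => mk_mem_prod (hmem x hx).1 (hmem x hx).2
  have hGc : ContinuousOn (fun x : Option (Fin N) → ℝ => (g (π₁ x) (x none), B (π₁ x) (x none))) (Icc l u) :=
    hcont.comp hπc.continuousOn hmaps
  have hFc : ContinuousOn F (Icc l u) := by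
    refine continuousOn_pi.2 fun o => ?_
    cases o with
    | none => exact continuous_fst.comp_continuousOn hGc
    | some j => exact (((continuous_apply j).comp continuous_snd).comp_continuousOn hGc).neg
  obtain ⟨x, hx, h0⟩ := Literature.Analysis.ValidatedNumerics.Miranda.exists_zero_of_miranda hlu hFc
    (fun x hx o ho => by
      cases o with
      | none =>
        show g (π₁ x) (x none) ≤ 0
        rw [ho]; exact hga _ (hmem x hx).1
      | some j =>
        show - B (π₁ x) (x none) j ≤ 0
        rw [neg_nonpos]; exact hB0 _ (hmem x hx).1 _ (hmem x hx).2 j ho)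
    (fun x hx o ho => by
      cases o with
      | none =>
        show 0 ≤ g (π₁ x) (x none)
        rw [ho]; exact hgb _ (hmem x hx).1
      | some j =>
        show 0 ≤ - B (π₁ x) (x none) j
        rw [neg_nonneg]; exact hB1 _ (hmem x hx).1 _ (hmem x hx).2 j ho)
  refine ⟨π₁ x, x none, (hmem x hx).1, (hmem x hx).2, fun j => ?_, ?_⟩
  · have h := congrFun h0 (some j)
    exact neg_eq_zero.mp h
  · exact congrFun h0 none

/-- The same with the OPPOSITE orientation of the rate coordinate (`g ≥ 0` at `β = a`, `g ≤ 0` at `β = b`). -/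
theorem poincareMiranda_cube_prod' (N : ℕ) {a b : ℝ} (hab : a ≤ b)
    (B : (Fin N → ℝ) → ℝ → Fin N → ℝ) (g : (Fin N → ℝ) → ℝ → ℝ)
    (hcont : ContinuousOn (fun q : (Fin N → ℝ) × ℝ => (g q.1 q.2, B q.1 q.2))
      ({p : Fin N → ℝ | ∀ i, p i ∈ Icc (0:ℝ) 1} ×ˢ Icc a b))
    (hB0 : ∀ p : Fin N → ℝ, (∀ i, p i ∈ Icc (0:ℝ) 1) → ∀ β ∈ Icc a b, ∀ j, p j = 0 → 0 ≤ B p β j)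
    (hB1 : ∀ p : Fin N → ℝ, (∀ i, p i ∈ Icc (0:ℝ) 1) → ∀ β ∈ Icc a b, ∀ j, p j = 1 → B p β j ≤ 0)
    (hga : ∀ p : Fin N → ℝ, (∀ i, p i ∈ Icc (0:ℝ) 1) → 0 ≤ g p a)
    (hgb : ∀ p : Fin N → ℝ, (∀ i, p i ∈ Icc (0:ℝ) 1) → g p b ≤ 0) :
    ∃ (p : Fin N → ℝ) (β : ℝ), (∀ i, p i ∈ Icc (0:ℝ) 1) ∧ β ∈ Icc a b ∧ (∀ j, B p β j = 0) ∧ g p β = 0 := by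
  obtain ⟨p, β, hp, hβ, hB, hg⟩ := poincareMiranda_cube_prod N hab B (fun p β => - g p β)
    ((continuous_neg.comp_continuousOn (continuous_fst.comp_continuousOn hcont)).prodMk (continuous_snd.comp_continuousOn hcont))
    hB0 hB1 (fun p hp => by rw [neg_nonpos]; exact hga p hp) (fun p hp => by rw [neg_nonneg]; exact hgb p hp)
  exact ⟨p, β, hp, hβ, hB, neg_eq_zero.mp hg⟩

/-! ## The face arithmetic of the exported area law -/

/-- **Face signs from the export law.**  If `k₀ ≤ k` and `Γ·|B − k·F⁰| ≤ Ce` with `0 < k₀`, `0 < κ`, `0 < Γ`, `Ce < k₀·κ·Γ`, then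
`F⁰ ≥ κ ⇒ B > 0` and `F⁰ ≤ −κ ⇒ B < 0`. -/
theorem exportLaw_face_signs {Γ k₀ κ Ce k F0 B : ℝ} (hk₀ : 0 < k₀) (hκ : 0 < κ) (hΓ : 0 < Γ) (hCe : Ce < k₀ * κ * Γ)
    (hk : k₀ ≤ k) (hexp : Γ * |B - k * F0| ≤ Ce) :
    (κ ≤ F0 → 0 < B) ∧ (F0 ≤ -κ → B < 0) := by
  have hk0 : 0 ≤ k := hk₀.le.trans hk
  have habs : |B - k * F0| * Γ ≤ Ce := by rw [mul_comm]; exact hexp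
  have h1 : (B - k * F0) * Γ ≤ Ce := (mul_le_mul_of_nonneg_right (le_abs_self _) hΓ.le).trans habs
  have h2 : -(B - k * F0) * Γ ≤ Ce := (mul_le_mul_of_nonneg_right (neg_le_abs _) hΓ.le).trans habs
  have hkκ : k₀ * κ ≤ k * κ := mul_le_mul_of_nonneg_right hk hκ.le
  constructor
  · intro hF
    have hkF : k * κ ≤ k * F0 := mul_le_mul_of_nonneg_left hF hk0
    -- `B Γ ≥ k F0 Γ − Ce ≥ k₀ κ Γ − Ce > 0`
    have h3 : k₀ * κ * Γ ≤ k * F0 * Γ := mul_le_mul_of_nonneg_right (hkκ.trans hkF) hΓ.le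
    have h4 : 0 < B * Γ := by nlinarith
    by_contra hB
    push Not at hB
    nlinarith
  · intro hF
    have hkF : k * F0 ≤ k * (-κ) := mul_le_mul_of_nonneg_left hF hk0
    have h3 : k * F0 * Γ ≤ -(k₀ * κ) * Γ := by
      have : k * F0 ≤ -(k₀ * κ) := by nlinarith
      exact mul_le_mul_of_nonneg_right this hΓ.le
    have h4 : B * Γ < 0 := by nlinarith
    by_contra hB
    push Not at hB
    nlinarith

/-- **The selection step of «A1R-acc» (analytic core of the future glue `Selection1ARacc`).**  On the core-area box `[0,1]^N` times a rate
window `[a,b]`: accretion multipliers `B` and gains `k` obeying the EXPORTED affine area law `k₀ ≤ k ∧ Γ·|B − k·F⁰| ≤ Ce` against face data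
`F⁰` with margins `F⁰ ≥ κ` on `p_j = 0` and `F⁰ ≤ −κ` on `p_j = 1`, a rate defect `g` with `g(p, a) < 0 < g(p, b)`, `(g, B)` jointly
continuous on the box, and `Γ` past the threshold `Ce < k₀·κ·Γ`: then `B(p⋆, β⋆) = 0` and `g(p⋆, β⋆) = 0` for some `(p⋆, β⋆)` in the box. -/
theorem accretionBox_selection (N : ℕ) {a b Γ k₀ κ Ce : ℝ} (hab : a ≤ b) (hk₀ : 0 < k₀) (hκ : 0 < κ) (hΓ : 0 < Γ)
    (hCe : Ce < k₀ * κ * Γ) (F0 : (Fin N → ℝ) → Fin N → ℝ) (B k : (Fin N → ℝ) → ℝ → Fin N → ℝ) (g : (Fin N → ℝ) → ℝ → ℝ)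
    (hcont : ContinuousOn (fun q : (Fin N → ℝ) × ℝ => (g q.1 q.2, B q.1 q.2))
      ({p : Fin N → ℝ | ∀ i, p i ∈ Icc (0:ℝ) 1} ×ˢ Icc a b))
    (hface : ∀ (j : Fin N) (p : Fin N → ℝ), (∀ i, p i ∈ Icc (0:ℝ) 1) → (p j = 0 → κ ≤ F0 p j) ∧ (p j = 1 → F0 p j ≤ -κ))
    (hexp : ∀ p : Fin N → ℝ, (∀ i, p i ∈ Icc (0:ℝ) 1) → ∀ β ∈ Icc a b, ∀ j, k₀ ≤ k p β j ∧ Γ * |B p β j - k p β j * F0 p j| ≤ Ce)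
    (hg : ∀ p : Fin N → ℝ, (∀ i, p i ∈ Icc (0:ℝ) 1) → g p a < 0 ∧ 0 < g p b) :
    ∃ (p : Fin N → ℝ) (β : ℝ), (∀ i, p i ∈ Icc (0:ℝ) 1) ∧ β ∈ Icc a b ∧ (∀ j, B p β j = 0) ∧ g p β = 0 :=
  poincareMiranda_cube_prod N hab B g hcont
    (fun p hp β hβ j hj => ((exportLaw_face_signs hk₀ hκ hΓ hCe (hexp p hp β hβ j).1 (hexp p hp β hβ j).2).1 ((hface j p hp).1 hj)).le)
    (fun p hp β hβ j hj => ((exportLaw_face_signs hk₀ hκ hΓ hCe (hexp p hp β hβ j).1 (hexp p hp β hβ j).2).2 ((hface j p hp).2 hj)).le)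
    (fun p hp => (hg p hp).1.le) (fun p hp => (hg p hp).2.le)

/-- A convenient threshold: `Ce < k₀·κ·Γ` once `Γ ≥ |Ce|/(k₀κ) + 1`. -/
theorem exportLaw_threshold {k₀ κ Ce Γ : ℝ} (hk₀ : 0 < k₀) (hκ : 0 < κ) (hΓ : |Ce| / (k₀ * κ) + 1 ≤ Γ) : Ce < k₀ * κ * Γ := by
  have hkκ : 0 < k₀ * κ := mul_pos hk₀ hκ
  have h1 : |Ce| / (k₀ * κ) * (k₀ * κ) = |Ce| := div_mul_cancel₀ _ hkκ.ne'
  have h2 : (|Ce| / (k₀ * κ) + 1) * (k₀ * κ) ≤ Γ * (k₀ * κ) := mul_le_mul_of_nonneg_right hΓ hkκ.le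
  have h3 : |Ce| + k₀ * κ ≤ Γ * (k₀ * κ) := by rw [add_mul, h1, one_mul] at h2; exact h2
  calc Ce ≤ |Ce| := le_abs_self _
    _ < |Ce| + k₀ * κ := lt_add_of_pos_right _ hkκ
    _ ≤ Γ * (k₀ * κ) := h3
    _ = k₀ * κ * Γ := by ring

end Summit.NavierStokesRegularity.NavierStokesRegularity.Theorems.DefectColumnGate

end
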